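import Literature.Analysis.FluidPDE.ClassicalSolution
import Literature.Analysis.FluidPDE.LerayHopf
import Literature.Analysis.FluidPDE.NSWave0
import HarnessLib

/-!
# Miller's regularity criterion via the middle eigenvalue of the strain tensor (Miller 2019, Thm. 1.1)

Analysis/FluidPDE named fact (nothing asserted, `def … : Prop`), vendored by a grounder as the
nearest print for the route `HodographBetchov` of Navier–Stokes regularity
(`Summit.NavierStokesRegularity.NavierStokesRegularity.Theses.HodographBetchov.FastClassSqueeze`,
crux `stmt-NavierStokesRegularity-15832`, and the support `…HodographBetchov.LocalisedMiller`,
`stmt-NavierStokesRegularity-15833`), which *localise* the criterion below to the fast velocity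
class `{x : l < ‖u(t,x)‖}`; the global statement is what is in print.

**Printed statement** (E. Miller, *A regularity criterion for the Navier–Stokes equation
involving only the middle eigenvalue of the strain tensor*, Arch. Ration. Mech. Anal. 235 (2020)
99–139 = arXiv:1710.05569, **Theorem 1.1**, p. 5 of the arXiv text, restated and proved as
Thm. 5.2, p. 16): *Let `u ∈ C([0,T]; Ḣ¹(ℝ³))` for all `T < T_max` be a mild solution to the
Navier–Stokes equation, and let `λ₁(x) ≤ λ₂(x) ≤ λ₃(x)` be the eigenvalues of the strain tensor
`S(x) = ∇_sym u(x)`. Let `λ₂⁺(x) = max {λ₂(x), 0}`. If `2/p + 3/q = 2` with `3/2 < q ≤ +∞`, then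
`‖u(·,T)‖²_{Ḣ¹} ≤ ‖u⁰‖²_{Ḣ¹} exp (C_q ∫₀ᵀ ‖λ₂⁺(·,t)‖^p_{L^q(ℝ³)} dt)`, with the constant `C_q`
depending only on `q`. In particular if `T_max < +∞`, where `T_max` is the maximal existence time
for a smooth solution, then `∫₀^{T_max} ‖λ₂⁺(·,t)‖^p_{L^q(ℝ³)} dt = +∞`.* (Viscosity is
normalised to `1`, eq. (1.1) p. 4: `∂ₜu − Δu + (u·∇)u + ∇p = 0`.) Miller's Addendum (Arch.
Ration. Mech. Anal. 237 (2020), doi:10.1007/s00205-020-01527-1) records the priority of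
Neustupa–Penel 2001 for criteria on the positive part of the middle eigenvalue.

**Rendering** (the continuation clause "in particular …", contraposed, in the house vocabulary of
`ClassicalSolution.lean` / `LerayHopf.lean`; every deviation makes the fact WEAKER than print):

* solution class: a classical solution `(u, p)` of the unforced system with viscosity `ν > 0` on
  `ℝ³ × [0, T)` (`IsClassicalNSSolutionOn (Ico 0 T) ν 0 u p`) which is Leray–Hopf from a rapidly
  decaying datum (`IsLerayHopfOn T ν 0 (u 0) u`, `HasRapidSpatialDecay (u 0)`) — the hypothesis
  package of the Clay-side items of the route. By weak–strong uniqueness (tree: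
  `serrin_weak_strong_uniqueness_holds`) such a `u` coincides on `[0, min (T, T_max))` with the
  `Ḣ¹`-mild solution from `u 0` (Kato–Fujita; Miller Thm. 4.1), to which the printed theorem
  applies; if `T_max ≤ T` the printed conclusion `∫₀^{T_max} ‖λ₂⁺‖^p_q = ∞` contradicts the
  finiteness hypothesis below (the integrand is pointwise dominated on `[0, T_max)`), so
  `T_max > T` and the smooth mild solution is the required extension (`HasSmoothExtensionPast`).
  General `ν > 0` reduces to `ν = 1` by `v(x, s) = ν⁻¹ u(x, s/ν)` (strain scales by `ν⁻²`, time
  by `ν`; finiteness of the mixed norm is invariant);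
* `λ₂⁺ ≤ m`: instead of naming the eigenvalue we take any measurable-or-not **nonnegative
  majorant** `m(t, x) ≥ 0` of the middle strain eigenvalue in the two-frame Courant–Fischer form
  (Horn–Johnson Thm. 4.2.6; tree: `strainEigenvalues_mid_le_iff` in
  `LerayGaugeStrainSpectrum.lean`): at every `(t, x)` some orthonormal pair `v, w` with
  `⟪∇u(t,x)(αv + βw), αv + βw⟫ ≤ m(t,x) (α² + β²)` for all `α, β` (the quadratic forms of `∇u` and
  `S = ½(∇u + ∇uᵀ)` agree), i.e. `λ₂(S(t,x)) ≤ m(t,x)`, hence `λ₂⁺ ≤ m` and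
  `‖λ₂⁺(t)‖_{L^q} ≤ ‖m(t)‖_{L^q}`;
* exponents: `q` real with `3/2 < q` (the endpoint `q = ∞` is omitted), `p = 2q/(2q − 3)` so that
  `‖m(t)‖^p_{L^q} = (∫ m(t,x)^q dx)^{2/(2q−3)}`, written with lower Lebesgue integrals in `ℝ≥0∞`;
  the time integral runs over `(0, T)`.

This is exactly the shape of the route items with the fast-class restriction `{l < ‖u t x‖}`
removed, so `LocalisedMiller` at level `l` with an empty slow-class contribution is this fact.

## References

* [Miller2019] E. Miller, Arch. Ration. Mech. Anal. 235 (2020), no. 1, 99–139,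
  doi:10.1007/s00205-019-01419-z, arXiv:1710.05569 — Theorem 1.1 (= Thm. 5.2), Lemma 5.1
  (`−det S ≤ ½ |S|² λ₂⁺`).
* [NeustupaPenel2001] J. Neustupa, P. Penel, in *Mathematical Fluid Mechanics*, Birkhäuser 2001,
  237–265, doi:10.1007/978-3-0348-8243-9_10 (priority for the `λ₂⁺` criterion, per Miller's
  Addendum doi:10.1007/s00205-020-01527-1).
-/

namespace Literature.Analysis.FluidPDE

open MeasureTheory Set

/-- **Miller's middle-eigenvalue regularity criterion** (continuation form). Let `ν > 0`, `T > 0`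
and let `(u, p)` be a classical solution of the unforced Navier–Stokes system on `ℝ³ × [0, T)`
which is Leray–Hopf from the rapidly decaying datum `u 0`. Let `3/2 < q < ∞` and let
`m ≥ 0` be a pointwise majorant of the middle eigenvalue of the strain `S = ½(∇u + ∇uᵀ)` on
`[0, T) × ℝ³` in Courant–Fischer form (at each point some orthonormal `v, w` with
`⟪∇u (αv+βw), αv+βw⟫ ≤ m (α²+β²)` for all `α, β`). If
`∫₀ᵀ (∫ m(t,x)^q dx)^{2/(2q−3)} dt < ∞` — i.e. `‖m‖_{L^p_t L^q_x} < ∞` with `2/p + 3/q = 2` — then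
`u` extends to a classical solution past `T`. Printed: "Let `u ∈ C([0,T];Ḣ¹(ℝ³))` for all
`T < T_max` be a mild solution …, `λ₂⁺ = max{λ₂, 0}`. If `2/p + 3/q = 2` with `3/2 < q ≤ +∞`,
then `‖u(·,T)‖²_{Ḣ¹} ≤ ‖u⁰‖²_{Ḣ¹} exp(C_q ∫₀ᵀ ‖λ₂⁺(·,t)‖^p_{L^q} dt)` … In particular if
`T_max < +∞` … then `∫₀^{T_max} ‖λ₂⁺(·,t)‖^p_{L^q(ℝ³)} dt = +∞`." This rendering (classical
Leray–Hopf solutions from decaying data are the `Ḣ¹`-mild solutions by weak–strong uniqueness;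
`λ₂⁺ ≤ m`; finite `q`; viscosity by scaling) is implied by the printed theorem; it is the global
(`l = 0`) case of `Summit.NavierStokesRegularity.NavierStokesRegularity.Theses.HodographBetchov.LocalisedMiller`
and the hypothesis whose a-priori validity on the fast class is
`Summit.NavierStokesRegularity.NavierStokesRegularity.Theses.HodographBetchov.FastClassSqueeze`.
[cite: Miller2019, Thm 1.1] -/
def Miller2019.middleEigenvalueCriterion : Prop :=
  ∀ (ν T : ℝ), 0 < ν → 0 < T →
  ∀ (u : ℝ → EuclideanSpace ℝ (Fin 3) → EuclideanSpace ℝ (Fin 3))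
    (p : ℝ → EuclideanSpace ℝ (Fin 3) → ℝ),
    IsClassicalNSSolutionOn (Set.Ico 0 T) ν 0 u p →
    IsLerayHopfOn T ν 0 (u 0) u →
    HasRapidSpatialDecay (u 0) →
    ∀ q : ℝ, 3 / 2 < q →
    ∀ m : ℝ → EuclideanSpace ℝ (Fin 3) → ℝ, (∀ t x, 0 ≤ m t x) →
      (∀ t ∈ Set.Ico 0 T, ∀ x, ∃ v w : EuclideanSpace ℝ (Fin 3),
          ‖v‖ = 1 ∧ ‖w‖ = 1 ∧ inner ℝ v w = 0 ∧
          ∀ α β : ℝ, inner ℝ (fderiv ℝ (u t) x (α • v + β • w)) (α • v + β • w)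
            ≤ m t x * (α ^ 2 + β ^ 2)) →
      ∫⁻ t in Set.Ioo 0 T, (∫⁻ x, ENNReal.ofReal (m t x) ^ q) ^ (2 / (2 * q - 3)) < ⊤ →
      HasSmoothExtensionPast ν 0 u T

end Literature.Analysis.FluidPDE
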